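import Summits.BirchSwinnertonDyer.Rank1Residual.X4.KuriharaLevelLowering
import Summits.BirchSwinnertonDyer.Rank1Residual.Additive.KuriharaNumberModulusReduction
import HarnessLib

/-!
# Level lowering kills Kurihara numbers modulo `p^e`: the EXPONENT form of the certificate (`PlusSymbolLevelLowersModAt W p f (p^e) ℓ`) forces `δ̃_n^{(k)} = 0` for every `k ≤ e`, `n ∈ 𝒩_k`, hence `∂^{(∞)}(δ̃) ≥ e` (cell `b2b-bsdres`, seat additive-p4 gen 29, line V49; CLASS-CLOSURE §3.1 N11 / §3.2 N10, the `ord_p ∏ c ≥ 3` rows)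

HONEST FRAMING (verbatim, cell `b2b-bsdres`): the goal of the cell is to DELETE the COMBINATION-SHAPED
residual classes for ALL analytic-rank `≤ 1` curves over `ℚ` — "full BSD formula for every rank `≤ 1`
curve in class `C`" assembled STRICTLY from published theorems — so that the rank-`≤ 1` remainder
becomes exactly the CONSTRUCTION-SHAPED classes, which are TYPED (missing-input Props), NOT attempted;
this is not "finishing BSD". This file: a research-route KERNEL THEOREM (pure algebra over the tree's
`kuriharaNumber`; no named fact, no conjecture, nothing booked; X4 stays CONSTRUCTION-SHAPED; no
Literature fact is minted; labels unchanged).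

## What is proved

Gen 20 (`X4/KuriharaLevelLowering.lean`) proved: a mod-`p` OLDFORM identity for the plus symbol of `f`
at `ℓ ∣ N_E` — the FINITE certificate `PlusSymbolLevelLowersAt W p f ℓ`: `[r]⁺_f ≡ μ(r) − μ(ℓ r)
(mod p)` with `μ : ℚ → ℤ/p` periodic and `T_q`-eigen (`a_q(E)`) at the Kolyvagin primes — forces
EVERY mod-`p` Kurihara number `δ̃_n^{(1)}` to vanish, `∂^{(∞)}(δ̃) ≥ 1`. The descent identity behind it
(`kuriharaSum_oldform_eq_zero`, parts 1–2) is stated over an ARBITRARY commutative ring. This file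
runs it over `ℤ/p^k`:

* `PlusSymbolLevelLowersModAt W p f m ℓ` — the certificate at the modulus `m`, in the currency of the
  tree's `kuriharaNumber` (`ratModP m`, the reduction `ℤ_(p) → ℤ/p^k` on `p`-integral rationals):
  `∃ μ : ℚ → ℤ/m` periodic, `T_q`-eigen with eigenvalue `a_q(E) mod m` at every Kolyvagin prime
  `q ∈ 𝒫_1(E, p)`, with `\overline{[r]⁺_f} = μ(r) − μ(ℓ r)` for all `r`. At `m = p` it IS gen 20's
  certificate (`plusSymbolLevelLowersModAt_iff`).
* `kuriharaNumber_eq_zero_of_plusSymbolLevelLowersModAt` — the certificate at `m = p^e`, `ℓ ∣ N_E`,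
  `k ≤ e`, `n ∈ 𝒩_k(E, p)` and `p`-INTEGRAL symbols `[a/n]⁺_f` ⟹ `kuriharaNumber f (p^k) n ψ = 0` for
  EVERY `ψ`. (Reduce `μ` along `ℤ/p^e → ℤ/p^k`: the Kolyvagin primes of `n` have `a_q ≡ q + 1 ≡ 2
  (mod p^k)`, the reduction commutes with `ratModP` on `p`-integral rationals
  (`KuriharaReduction.castHom_ratModP_pow`; FALSE without integrality — the junk inverses of `ZMod`),
  and the descent identity over `ℤ/p^k` kills the sum.)
* `kuriharaDivisibleAt_of_plusSymbolLevelLowersModAt`, `le_kuriharaPartialInfty_of_…`,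
  `pow_min_dvd_kuriharaNumber_of_…` — for the newform `D.f` of an elliptic curve with `E[p]`
  irreducible, `p` odd, conductor `= N` (so the symbols at Kolyvagin levels are `p`-integral,
  `IsNewformOf.not_dvd_den_ratPlusSymbol_div`): `δ̃_n ∈ p^e ℤ_p/I_nℤ_p` at every level,
  **`∂^{(∞)}(δ̃) ≥ e`**, and the E67 hypothesis `p^{min(e,k)} ∣ δ̃_n^{(k)}` (Kim Thm. 1.8 (6) read with
  `∂^{(∞)} ≥ e`).

Consumers (`X4/KimDefectLevelLoweringModPow.lean`): the ONE-FACTOR socket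
`X4.bsdp_of_le_kimDefect_of_tamagawa_le_add_one_of_shaAn_unit` with `α = e` closes the unit rows with
**`ord_p ∏_v c_v ≤ e + 1`** — the `ord_p ∏ c ≥ 3` rows of TAM-DEFECT (N10 at `p ≥ 5`: 4 sweep rows;
N11 at `p = 3`: 235 sweep rows, seat census V47-B) whose defect is carried by ONE prime `ℓ` with
`ord_p c_ℓ = e ≥ 2` — per pair, from a FINITE mod-`p^e` certificate (two modular-symbol lattices
mod `p^e`), on published inputs at `p ≥ 5` and modulo the announced Kim 2025 clause at `p = 3`; and
the rank-one rows from the certificate plus ONE Kurihara number `≢ 0 (mod p^{e+1})`.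

## Where the certificate comes from (NOT asserted here; EVIDENCE per row)

For `f = f_E`, `E[p]` irreducible, `ℓ ∥ N` split multiplicative with `p^e ∣ c_ℓ = v_ℓ(Δ_min)`, the
Tate parametrisation shows `E[p^e]` is UNRAMIFIED at `ℓ`; the mod-`p^e` eigen-character of `f` is then
EXPECTED to factor through the `ℓ`-old Hecke algebra of level `N/ℓ` ("quantitative level lowering",
Kim–Kim–Sun 2020 Rem. 2.3; Kim 2026 Conj. 1.10 predicts exactly `∂^{(∞)}(δ̃) = ∑_ℓ ord_p c_ℓ`). THIS
HALF IS IN PRINT on the rows with `ℓ ≢ 1 (mod p)`: Dummigan's level-lowering for higher congruences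
(unpublished 2015; quoted as Thm. 15 of the Tsaknias–Wiese survey) — `f ∈ S_k(Γ₁(Mℓ))`, `ℓ ∤ M`,
`ℓ ≢ 1 (mod p)`, `2 ≤ k < p + 2`, residually irreducible, `ρ_f mod p^m` unramified at `ℓ` ⟹ a WEAK
eigenform of level `Γ₁(M)` congruent to `f` modulo `p^m` away from `ℓ`, with NO hypothesis on the
level at `p` (so `p² ∣ N` is allowed); Camporino–Pacetti (ibid. Thm. 16: `p ≥ 7`, big image) and
Dahmen–Yazdani 2012 Thm. 2 (`l² ∤ N`, unique congruent newform — not available on X4) are the other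
printed forms. What is NOT in print on the cell's class X4 is the SYMBOL step: the identity of
mod-`p^e` modular symbols needs a mod-`p^e` multiplicity-one / freeness input for the `𝔫`-part of
`H₁(X₀(N), ℤ)`. Hence, exactly as at `e = 1`: a per-pair FINITE certificate decided by the cell's
instrument (E7 `llcertpow.gp` at the levels `N`, `N/ℓ`; gen 29: `EMAX = ord_p c_ℓ` on every decided
row) — EVIDENCE, never a Literature fact. Nothing here depends on it.

## References

* B. Mazur, J. Tate, J. Teitelbaum, Invent. Math. 84 (1986), §I.4 (4.2). [cite: MazurTateTeitelbaum1986Invent, §I.4 (4.2)]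
* M. Kurihara, Contrib. Math. Comput. Sci. 7 (2014) 317–356, §1.1 (1)–(2). [cite: Kurihara2014, §1.1]
* C.-H. Kim, Amer. J. Math. 148 (2026), §1.4.3, §1.5.1, Thm. 1.9 (6), Conj. 1.10. [cite: Kim2022StructureSelmer, §1.5.1 and Conj. 1.10 (PDF pp. 7–8)]
* C.-H. Kim, M. Kim, H.-S. Sun, Selecta Math. 26 (2020), Rem. 2.3. [cite: KimKimSun2020Selecta, Rem. 2.3]
* S. R. Dahmen, S. Yazdani, Canad. J. Math. 64 (2012) 282–300, Thm. 2 (why a mod-`p^e` certificate is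
  expected at `ℓ ∥ N`, `p^e ∣ v_ℓ(Δ)`; hypotheses `l² ∤ N` — not an input here). [cite: DahmenYazdani2012, Thm. 2]
* P. Tsaknias, G. Wiese, *Topics on modular Galois representations modulo prime powers* (2017), Thm. 15
  (Dummigan's level lowering modulo `λ^m` at `ℓ ≢ 1 (mod p)`, any level at `p`) and Thm. 16
  (Camporino–Pacetti) — provenance of the Hecke half of the certificate; not an input here. [cite: TsakniasWiese2017, Thm. 15 and Thm. 16 (arXiv p. 9)]
-/

noncomputable section

open scoped MatrixGroups ModularForm

open CongruenceSubgroup Finset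

open Literature.NumberTheory.EllipticCurves Literature.NumberTheory.EllipticCurves.ModularForms

open Literature.NumberTheory.DiophantineGeometry.Dioph (ratModP)

namespace Summit.BirchSwinnertonDyer.Rank1Residual.LevelLowering

variable {R : Type*}

/-! ### §1 Transport of periodicity and of the Hecke relation along a map of coefficients -/

section Transport

/-- Periodicity is preserved by post-composition with any map of coefficients. [folklore] -/
theorem IsPeriodic.map {S : Type*} {μ : ℚ → R} (hμ : IsPeriodic μ) (φ : R → S) :
    IsPeriodic (φ ∘ μ) :=
  fun r z ↦ by simp only [Function.comp_apply, hμ r z]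

/-- The Hecke relation `∑_j μ((r+j)/q) + μ(q r) = a μ(r)` is preserved by a ring homomorphism of
coefficients, with eigenvalue `φ a`. [cite: MazurTateTeitelbaum1986Invent, §I.4 (4.2)] -/
theorem HeckeRel.map [CommRing R] {S : Type*} [CommRing S] {μ : ℚ → R} {q : ℕ} {a : R}
    (h : HeckeRel μ q a) (φ : R →+* S) : HeckeRel (φ ∘ μ) q (φ a) := fun r ↦ by
  have := congrArg φ (h r)
  simpa only [map_add, map_sum, map_mul, Function.comp_apply] using this

end Transport

/-! ### §2 The certificate at a modulus `m` and the vanishing of the mod-`p^k` Kurihara numbers -/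

section ModPow

variable (W : WeierstrassCurve ℚ) [W.IsGloballyMinimal] (p : ℕ) {N : ℕ} (f : CuspForm (Gamma0 N) 2)

/-- **LEVEL-LOWERING CERTIFICATE for the plus symbol of `f` at `ℓ`, MODULO `m`** (a FINITE object:
two modular-symbol lattices reduced mod `m`), in the currency of the tree's `kuriharaNumber`
(`\overline{q} = ratModP m q`, the reduction `ℤ_(p) → ℤ/p^k` of a `p`-integral rational when
`m = p^k`, `ratModP_eq_toZModPow`): there is a `1`-periodic `μ : ℚ → ℤ/m` which is `T_q`-eigen with
eigenvalue `a_q(E) mod m` at every Kolyvagin prime `q ∈ 𝒫_1(E, p)` (`q ∤ Np`, `q ≡ 1`,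
`a_q ≡ q + 1 (mod p)`; Kim §1.2.2) and whose `ℓ`-old difference is the reduced plus symbol of `f`:
`\overline{[r]⁺_f} = μ(r) − μ(ℓ·r)` for every `r ∈ ℚ`. At `m = p` this is gen 20's
`PlusSymbolLevelLowersAt` (`plusSymbolLevelLowersModAt_iff`). WHERE IT COMES FROM at `m = p^e` (not
asserted here): `p^e ∣ c_ℓ(E)` at a split multiplicative `ℓ ∥ N` makes `E[p^e]` unramified at `ℓ`
(Tate curve), and the mod-`p^e` eigen-character of `f_E` factors through the `ℓ`-old Hecke algebra
of level `N/ℓ` — in print for `ℓ ≢ 1 (mod p)` with no condition at `p` (Dummigan, via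
Tsaknias–Wiese Thm. 15; weak eigenform mod `λ^m`), and under `l² ∤ N` + uniqueness
(Dahmen–Yazdani 2012 Thm. 2); the identity of SYMBOLS needs a mod-`p^e` multiplicity-one input on
top, not in print on X4. A per-pair certificate (cell instrument E7; EVIDENCE), never a fact. A
predicate; nothing asserted. [cite: Kim2022StructureSelmer, §1.2.2 and §1.4.3 (PDF pp. 5, 7)]
[cite: TsakniasWiese2017, Thm. 15 (arXiv p. 9)] [cite: DahmenYazdani2012, Thm. 2]
[cite: MazurTateTeitelbaum1986Invent, §I.4 (4.2)] -/
def PlusSymbolLevelLowersModAt (m : ℕ) (ℓ : ℕ) : Prop :=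
  ∃ μ : ℚ → ZMod m, IsPeriodic μ ∧
    (∀ q : ℕ, Kato.IsKolyvaginPrime W p 1 q → HeckeRel μ q (W.frobeniusTrace q : ZMod m)) ∧
    ∀ r : ℚ, ratModP m (ratPlusSymbol f r) = μ r - μ (ℓ * r)

variable {W p f}

/-- **At the modulus `p` the certificate IS gen 20's** `PlusSymbolLevelLowersAt W p f ℓ`
(`ratModP p q = (q : ℤ/p)`, `ratModP_eq_ratCast`). [cite: Kim2022StructureSelmer, §1.4.3 (PDF p. 7)] -/
theorem plusSymbolLevelLowersModAt_iff [Fact p.Prime] {ℓ : ℕ} :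
    PlusSymbolLevelLowersModAt W p f p ℓ ↔ PlusSymbolLevelLowersAt W p f ℓ := by
  unfold PlusSymbolLevelLowersModAt PlusSymbolLevelLowersAt
  refine exists_congr fun μ ↦ and_congr_right fun _ ↦ and_congr_right fun _ ↦ ?_
  refine forall_congr' fun r ↦ ?_
  rw [ratModP_eq_ratCast]

/-- **The certificate descends along `ℤ/m → ℤ/d` ON THE HECKE SIDE**: the reduction `φ ∘ μ` of the
witness is periodic and `T_q`-eigen with eigenvalue `a_q(E) mod d` at every `q ∈ 𝒫_1`; in particular
at a Kolyvagin prime `q ∈ 𝒫_k` and `d = p^k` the eigenvalue is `2` (`a_q ≡ q + 1 ≡ 2 (mod p^k)`).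
[cite: Kim2022StructureSelmer, §1.2.2 (PDF p. 5)] -/
theorem heckeRel_two_castHom_comp_of_isKolyvaginPrime {m k : ℕ} (hkm : p ^ k ∣ m)
    {μ : ℚ → ZMod m}
    (hH : ∀ q : ℕ, Kato.IsKolyvaginPrime W p 1 q → HeckeRel μ q (W.frobeniusTrace q : ZMod m))
    (hk : 1 ≤ k) {q : ℕ} (hq : Kato.IsKolyvaginPrime W p k q) :
    HeckeRel (ZMod.castHom hkm (ZMod (p ^ k)) ∘ μ) q 2 := by
  have h := (hH q (hq.mono hk)).map (ZMod.castHom hkm (ZMod (p ^ k)))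
  rwa [map_intCast, (Kato.isKolyvaginPrime_iff_zmod.mp hq).2.2.2] at h

/-- **EVERY mod-`p^k` Kurihara number vanishes under the mod-`p^e` certificate, `k ≤ e`**: if the
plus symbol of `f` level-lowers modulo `p^e` at some `ℓ ∣ N_E` (`PlusSymbolLevelLowersModAt W p f
(p^e) ℓ`), `n ∈ 𝒩_k(E, p)` with `k ≤ e`, and the symbols `[a/n]⁺_f` (`a ∈ (ℤ/n)ˣ`) are `p`-integral,
then `kuriharaNumber f (p^k) n ψ = 0` for EVERY choice of discrete logarithms `ψ` into `ℤ/p^k`. Proof: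
reduce the witness `μ` along `ℤ/p^e → ℤ/p^k` (the Kolyvagin primes of `n` become `T_q`-eigen primes
of eigenvalue `2`, and are prime to `ℓ ∣ N_E`), use that the reduction commutes with `ratModP` on
`p`-integral rationals (`KuriharaReduction.castHom_ratModP_pow`), and apply the ring-general descent
identity `kuriharaSum_oldform_eq_zero` over `ℤ/p^k`. (`k = 0`: `ℤ/p^0 = 0`.)
[cite: Kim2022StructureSelmer, §1.2.2 and §1.4.3 (PDF pp. 5, 7)] [cite: Kurihara2014, §1.1 (1)–(2)] -/
theorem kuriharaNumber_eq_zero_of_plusSymbolLevelLowersModAt [Fact p.Prime] {e ℓ : ℕ}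
    (hcert : PlusSymbolLevelLowersModAt W p f (p ^ e) ℓ) (hℓ : ℓ ∣ W.conductorNorm ℤ)
    {k : ℕ} (hk : k ≤ e) {n : ℕ} [NeZero n] (hn : Kato.IsKolyvaginProduct W p k n)
    (hden : ∀ a : (ZMod n)ˣ, ¬ p ∣ (ratPlusSymbol f (((a : ZMod n).val : ℚ) / n)).den)
    (ψ : (q : ℕ) → (ZMod q)ˣ →* Multiplicative (ZMod (p ^ k))) :
    kuriharaNumber f (p ^ k) n ψ = 0 := by
  rcases Nat.eq_zero_or_pos k with rfl | hk1
  · haveI : Subsingleton (ZMod (p ^ 0)) := ZMod.subsingleton_iff.mpr (pow_zero p)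
    exact Subsingleton.elim _ _
  obtain ⟨μ, hμ, hH, hsym⟩ := hcert
  set φ : ZMod (p ^ e) →+* ZMod (p ^ k) := ZMod.castHom (pow_dvd_pow p hk) (ZMod (p ^ k))
    with hφ
  have hμ' : IsPeriodic (φ ∘ μ) := hμ.map φ
  have hP : ∀ q, Kato.IsKolyvaginPrime W p k q → q.Prime ∧ HeckeRel (φ ∘ μ) q 2 := fun q hq ↦
    ⟨hq.prime, heckeRel_two_castHom_comp_of_isKolyvaginPrime (pow_dvd_pow p hk) hH hk1 hq⟩
  have hcop : ℓ.Coprime n := Nat.coprime_of_dvd fun k hk hkℓ hkn ↦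
    (hn.2 k (Nat.mem_primeFactors.mpr ⟨hk, hkn, NeZero.ne n⟩)).not_dvd_conductorNorm
      (dvd_trans hkℓ hℓ)
  have hterm : ∀ a : (ZMod n)ˣ,
      ratModP (p ^ k) (ratPlusSymbol f (((a : ZMod n).val : ℚ) / n)) =
        φ (μ ((((a : ZMod n).val : ℕ) : ℚ) / n)) -
          φ (μ ((ℓ : ℚ) * ((((a : ZMod n).val : ℕ) : ℚ) / n))) := by
    intro a
    rw [← Additive.KuriharaReduction.castHom_ratModP_pow p hk (hden a), hsym, map_sub]
  have hmain := kuriharaSum_oldform_eq_zero (μ := φ ∘ μ) ψ hμ' hP n hn.squarefree hn.2 hcop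
  rw [kuriharaNumber_def]
  refine (Finset.sum_congr rfl fun a _ ↦ ?_).trans hmain
  rw [prod_attach_toAdd_eq_weight, hterm a]
  rfl

/-- **The special case `k = e`**: the mod-`p^e` certificate kills every mod-`p^e` Kurihara number
at the levels `n ∈ 𝒩_e(E, p)` with `p`-integral symbols. [cite: Kim2022StructureSelmer, §1.4.3 (PDF p. 7)] -/
theorem kuriharaNumber_eq_zero_of_plusSymbolLevelLowersModAt_self [Fact p.Prime] {e ℓ : ℕ}
    (hcert : PlusSymbolLevelLowersModAt W p f (p ^ e) ℓ) (hℓ : ℓ ∣ W.conductorNorm ℤ)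
    {n : ℕ} [NeZero n] (hn : Kato.IsKolyvaginProduct W p e n)
    (hden : ∀ a : (ZMod n)ˣ, ¬ p ∣ (ratPlusSymbol f (((a : ZMod n).val : ℚ) / n)).den)
    (ψ : (q : ℕ) → (ZMod q)ˣ →* Multiplicative (ZMod (p ^ e))) :
    kuriharaNumber f (p ^ e) n ψ = 0 :=
  kuriharaNumber_eq_zero_of_plusSymbolLevelLowersModAt hcert hℓ le_rfl hn hden ψ

end ModPow

/-! ### §3 Application to the newform of an elliptic curve: `∂^{(∞)}(δ̃) ≥ e` -/

section Application

variable {W : WeierstrassCurve ℚ} [W.IsElliptic] [W.IsGloballyMinimal] {p : ℕ} [Fact p.Prime]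

/-- **`δ̃_n ∈ p^e ℤ_p/I_nℤ_p` at every level** (`KuriharaDivisibleAt … n e`, file
`KuriharaNumberInvariants`) for the newform `D.f` of an elliptic curve with `E[p]` irreducible, `p`
odd, conductor `= N` (so that the symbols at Kolyvagin levels are `p`-integral,
`IsNewformOf.not_dvd_den_ratPlusSymbol_div`), under the mod-`p^e` certificate at some `ℓ ∣ N_E`.
[cite: Kim2022StructureSelmer, §1.4.3 and §1.5.1 (PDF p. 7), Def. 2.13 (PDF p. 14)] -/
theorem kuriharaDivisibleAt_of_plusSymbolLevelLowersModAt
    (hp2 : p ≠ 2) (hirr : W.HasIrreducibleModPGaloisRep p) {N : ℕ} [NeZero N]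
    (D : ModularParametrizationData W N) (hN : W.conductorNorm ℤ = N) {e ℓ : ℕ}
    (hcert : PlusSymbolLevelLowersModAt W p D.f (p ^ e) ℓ) (hℓ : ℓ ∣ W.conductorNorm ℤ)
    (n : ℕ) : KuriharaDivisibleAt W p D.f n e := by
  intro k hk hkn ψ _
  haveI : NeZero n := ⟨hkn.ne_zero⟩
  have hcopN : n.Coprime N := by
    have := hkn.coprime
    rw [hN] at this
    exact Nat.Coprime.coprime_dvd_right (dvd_mul_right N p) this
  have hden : ∀ a : (ZMod n)ˣ, ¬ p ∣ (ratPlusSymbol D.f (((a : ZMod n).val : ℚ) / n)).den := by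
    intro a
    have hnd := D.isNewformOf.not_dvd_den_ratPlusSymbol_div hp2 hirr hcopN ((a : ZMod n).val : ℤ)
    rwa [Int.cast_natCast] at hnd
  exact kuriharaNumber_eq_zero_of_plusSymbolLevelLowersModAt hcert hℓ hk hkn hden ψ

/-- **`∂^{(∞)}(δ̃) ≥ e` under the mod-`p^e` certificate** (the tree's `kuriharaPartialInfty`, cyclic
levels): every divisibility index is `≥ e`. This is the input `α = e` of the ONE-FACTOR SOCKET
`X4.bsdp_of_le_kimDefect_of_tamagawa_le_add_one_of_shaAn_unit` (file `X4/KimDefectParity.lean`): the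
unit rows with `ord_p ∏_v c_v ≤ e + 1` close. Kim's Conjecture 1.10 predicts `∂^{(∞)} = ∑_ℓ ord_p c_ℓ`,
so on a row whose Tamagawa defect sits at ONE prime `ℓ` the maximal certified `e` should be
`ord_p c_ℓ` (seat instrument, gen 27 batch X: 4/4). [cite: Kim2022StructureSelmer, §1.5.1 (PDF p. 7) and Conj. 1.10 (PDF p. 8)] -/
theorem le_kuriharaPartialInfty_of_plusSymbolLevelLowersModAt
    (hp2 : p ≠ 2) (hirr : W.HasIrreducibleModPGaloisRep p) {N : ℕ} [NeZero N]
    (D : ModularParametrizationData W N) (hN : W.conductorNorm ℤ = N) {e ℓ : ℕ}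
    (hcert : PlusSymbolLevelLowersModAt W p D.f (p ^ e) ℓ) (hℓ : ℓ ∣ W.conductorNorm ℤ) :
    (e : ℕ∞) ≤ kuriharaPartialInfty W p D.f := by
  refine le_iInf fun i ↦ ?_
  rw [kuriharaPartial_def]
  refine le_iInf fun n ↦ le_iInf fun _ ↦ le_iInf fun _ ↦ ?_
  exact le_kuriharaDivIndex_of_divisibleAt W p D.f
    (kuriharaDivisibleAt_of_plusSymbolLevelLowersModAt hp2 hirr D hN hcert hℓ n)

/-- **The E67 hypothesis at `m = e`**: `p^{min(e,k)} ∣ δ̃_n^{(k)}` for every `k`, every `n ∈ 𝒩_k`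
and every surjective `ψ` — the universally quantified input of
`Kim2026.rankZero_padicValNat_sha_add_le_of_forall_pow_dvd_kuriharaNumber` (Kim Thm. 1.8 (6) read
with `∂^{(∞)} ≥ e`: `ord_p #Ш ≤ ord_p(L(E,1)/Ω) − e`) — under the mod-`p^e` certificate.
[cite: Kim2022StructureSelmer, Thm. 1.9 (6) (PDF p. 8), §1.5.1 (PDF p. 7)] -/
theorem pow_min_dvd_kuriharaNumber_of_plusSymbolLevelLowersModAt
    (hp2 : p ≠ 2) (hirr : W.HasIrreducibleModPGaloisRep p) {N : ℕ} [NeZero N]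
    (D : ModularParametrizationData W N) (hN : W.conductorNorm ℤ = N) {e ℓ : ℕ}
    (hcert : PlusSymbolLevelLowersModAt W p D.f (p ^ e) ℓ) (hℓ : ℓ ∣ W.conductorNorm ℤ)
    {k : ℕ} {n : ℕ} [NeZero n] (hn : Kato.IsKolyvaginProduct W p k n)
    (ψ : (q : ℕ) → (ZMod q)ˣ →* Multiplicative (ZMod (p ^ k)))
    (hψ : ∀ q ∈ n.primeFactors, Function.Surjective (ψ q)) :
    ((p ^ min e k : ℕ) : ZMod (p ^ k)) ∣ kuriharaNumber D.f (p ^ k) n ψ :=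
  Kim2026.pow_min_dvd_kuriharaNumber_of_kuriharaDivisibleAt W p hp2 hirr D hN hn
    (kuriharaDivisibleAt_of_plusSymbolLevelLowersModAt hp2 hirr D hN hcert hℓ n) ψ hψ

/-- **No Kurihara number of level `k ≤ e` is non-zero under the mod-`p^e` certificate** — the
instrument-scope corollary: on a row certified modulo `p^e`, the census's search for a unit (or
merely non-zero) `δ̃_n^{(k)}` can only fire at levels `k ≥ e + 1` (`n ∈ 𝒩_{e+1}`), i.e. the LOWER-half
witness on a rank-one Tamagawa row with `ord_p c_ℓ = e` is a Kurihara number modulo `p^{e+1}`.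
[cite: Kim2022StructureSelmer, §1.5.1 (PDF p. 7) and Rem. 6.2 (PDF p. 31)] -/
theorem kuriharaNumber_eq_zero_of_plusSymbolLevelLowersModAt_of_le
    (hp2 : p ≠ 2) (hirr : W.HasIrreducibleModPGaloisRep p) {N : ℕ} [NeZero N]
    (D : ModularParametrizationData W N) (hN : W.conductorNorm ℤ = N) {e ℓ : ℕ}
    (hcert : PlusSymbolLevelLowersModAt W p D.f (p ^ e) ℓ) (hℓ : ℓ ∣ W.conductorNorm ℤ)
    {k : ℕ} (hk : k ≤ e) {n : ℕ} [NeZero n] (hn : Kato.IsKolyvaginProduct W p k n)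
    (ψ : (q : ℕ) → (ZMod q)ˣ →* Multiplicative (ZMod (p ^ k))) :
    kuriharaNumber D.f (p ^ k) n ψ = 0 := by
  have hcopN : n.Coprime N := by
    have := hn.coprime
    rw [hN] at this
    exact Nat.Coprime.coprime_dvd_right (dvd_mul_right N p) this
  have hden : ∀ a : (ZMod n)ˣ, ¬ p ∣ (ratPlusSymbol D.f (((a : ZMod n).val : ℚ) / n)).den := by
    intro a
    have hnd := D.isNewformOf.not_dvd_den_ratPlusSymbol_div hp2 hirr hcopN ((a : ZMod n).val : ℤ)
    rwa [Int.cast_natCast] at hnd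
  exact kuriharaNumber_eq_zero_of_plusSymbolLevelLowersModAt hcert hℓ hk hn hden ψ

end Application

end Summit.BirchSwinnertonDyer.Rank1Residual.LevelLowering

end
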